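import Summits.ValiantsHypothesis.ValiantsHypothesis.Theorems.BarrierLeverPartitionMinorsHitByVPFrobeniusDoor

/-!
# Route BarrierLever — item `PartitionMinorsHitByVP` (stmt-ValiantsHypothesis-19717):
# the symbolic FROBENIUS DOOR in EVERY prime characteristic `p`

Helper file (`--supports stmt-ValiantsHypothesis-19717`; cell valiant-natproofs, rung V4, 𝒟-side door (c),
prover seat val-np-p6 gen 5). Closes NO item; definition-free. Sequel of `…HitByVPFrobeniusDoor` (same seat,
characteristic `2`).

WHY: kit census j281989 (this seat; rows = the Hamming ball `B([5], 2)`, ALL `C(32,16)` column families, exact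
arithmetic in GF(2^64)) found column families on which the characteristic-`2` symbolic generalized Vandermonde
`det [η_{u i}^{bin (w j)}]` VANISHES IDENTICALLY — e.g. binary weights `{8,…,21, 24, 25}`: after the common factor
`η^8` the exponents are `{0,…,13, 16, 17}`, the Schur factor is `s_{(2,2)} = h_2^2 − h_1 h_3`, and it is `0` on the
sixteen ball nodes modulo `2` (a shadow of `p_{2k} = p_k^2`). The SAME families are certified by the analogous
table in characteristic `3` (also `5`, `7`; seat check in GF(3^13), GF(5^9), GF(7^7)). Conjecture T1 of
`…BallUniversal` is untouched (these layouts are hit — val-np-p6 g4's integer table, kit j279751, exhaustive at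
`(5,2)`); what dies is only «the characteristic-2 Moore table alone is universal» (`MooreBallNonsingular 5 2` of
`…HitByVPMooreBall` is false). Hence the door for an arbitrary prime `p`:

* Moore table `X_(c,o) ↦ Y_o^(p^c)` over `ZMod p`; Frobenius additivity (`moore_lin_char`) gives the entry
  `η_{u i}^{bin_p (w j)}`, `bin_p W = Σ_{c ∈ W} p^c` (base-`p` digits `0/1`), `η_U = Y_none + Σ_{a∈U} Y_(some a)`;
* **`det_additiveZ_ne_zero_of_frobenius_char`**, **`exists_table_of_frobenius_char`**,
  **`partitionMinor_hit_of_frobenius_char`** (+ mirror `…_rows`): if that generalized Vandermonde is nonzero in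
  `𝔽_p[Y]` for SOME prime `p`, the integer additive matrix is nonsingular, a numeric complex table exists, and the
  layout is hit inside `SmallCircuits ℂ (h+h) 5` (`h ≥ 2`).

CONJECTURE F_* (seat memo RESIDUE-v7; killable): for every layout whose rows form a Hamming ball there is a prime
`p` for which the characteristic-`p` determinant is nonzero. WHAT THIS IS NOT: no unconditional class beyond the
hypothesis; nothing on CPM (20172/20195), crux 14610 or VP vs VNP.
-/

set_option linter.dupNamespace false

namespace Summit.ValiantsHypothesis.ValiantsHypothesis.Theorems.BarrierLever.FrobeniusDoor

open Finset MvPolynomial Matrix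
open Literature.Barriers.ValiantsHypothesis

noncomputable section

variable {h : ℕ}

section CharP

variable (p : ℕ) [hp : Fact p.Prime]

/-- **Frobenius additivity in characteristic `p`.** Under `X_(c,o) ↦ Y_o^(p^c)` the symbolic coordinate
`X_(c,none) + Σ_{a∈U} X_(c,some a)` becomes `η_U^(p^c)`. -/
theorem moore_lin_char (c : Fin h) (U : Finset (Fin h)) :
    eval₂Hom (Int.castRingHom (MvPolynomial (Option (Fin h)) (ZMod p)))
        (fun q : Fin h × Option (Fin h) =>
          (X q.2 : MvPolynomial (Option (Fin h)) (ZMod p)) ^ p ^ (q.1 : ℕ))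
        (X (c, none) + ∑ a ∈ U, X (c, some a) : MvPolynomial (Fin h × Option (Fin h)) ℤ) =
      ((X none + ∑ a ∈ U, X (some a) : MvPolynomial (Option (Fin h)) (ZMod p))) ^ p ^ (c : ℕ) := by
  simp only [map_add, map_sum, coe_eval₂Hom, eval₂_X]
  rw [add_pow_char_pow, sum_pow_char_pow]

/-- The characteristic-`p` Moore evaluation of the entry `(i, j)` is `η_{u i}^{bin_p (w j)}`,
`bin_p W = Σ_{c ∈ W} p^c`. -/
theorem moore_entry_char {ι : Type*} (u w : ι → Finset (Fin h)) (i j : ι) :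
    eval₂Hom (Int.castRingHom (MvPolynomial (Option (Fin h)) (ZMod p)))
        (fun q : Fin h × Option (Fin h) =>
          (X q.2 : MvPolynomial (Option (Fin h)) (ZMod p)) ^ p ^ (q.1 : ℕ))
        (∏ c ∈ w j, (X (c, none) + ∑ a ∈ u i, X (c, some a)) :
          MvPolynomial (Fin h × Option (Fin h)) ℤ) =
      ((X none + ∑ a ∈ u i, X (some a) : MvPolynomial (Option (Fin h)) (ZMod p))) ^
        (∑ c ∈ w j, p ^ (c : ℕ)) := by
  rw [map_prod, ← Finset.prod_pow_eq_pow_sum]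
  exact Finset.prod_congr rfl fun c _ => moore_lin_char p c (u i)

/-- **Integer model, characteristic `p`.** If `det [η_{u i}^{bin_p (w j)}] ≠ 0` in `𝔽_p[Y]`, the integer additive
matrix `[∏_{c ∈ w j} (X_(c,none) + Σ_{a∈u i} X_(c,some a))]` has nonzero determinant. -/
theorem det_additiveZ_ne_zero_of_frobenius_char {ι : Type*} [Fintype ι] [DecidableEq ι]
    (u w : ι → Finset (Fin h))
    (hF : (Matrix.of fun i j : ι =>
      ((X none + ∑ a ∈ u i, X (some a) : MvPolynomial (Option (Fin h)) (ZMod p))) ^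
        (∑ c ∈ w j, p ^ (c : ℕ))).det ≠ 0) :
    (Matrix.of fun i j : ι =>
      (∏ c ∈ w j, (X (c, none) + ∑ a ∈ u i, X (c, some a)) :
        MvPolynomial (Fin h × Option (Fin h)) ℤ)).det ≠ 0 := by
  let ψ : MvPolynomial (Fin h × Option (Fin h)) ℤ →+* MvPolynomial (Option (Fin h)) (ZMod p) :=
    eval₂Hom (Int.castRingHom (MvPolynomial (Option (Fin h)) (ZMod p)))
      (fun q : Fin h × Option (Fin h) => (X q.2 : MvPolynomial (Option (Fin h)) (ZMod p)) ^ p ^ (q.1 : ℕ))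
  have hmat : ψ.mapMatrix (Matrix.of fun i j : ι =>
      (∏ c ∈ w j, (X (c, none) + ∑ a ∈ u i, X (c, some a)) :
        MvPolynomial (Fin h × Option (Fin h)) ℤ)) =
      Matrix.of fun i j : ι =>
        ((X none + ∑ a ∈ u i, X (some a) : MvPolynomial (Option (Fin h)) (ZMod p))) ^
          (∑ c ∈ w j, p ^ (c : ℕ)) := by
    refine Matrix.ext fun i j => ?_
    rw [RingHom.mapMatrix_apply, Matrix.map_apply, Matrix.of_apply, Matrix.of_apply]
    exact moore_entry_char p u w i j
  intro h0
  apply hF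
  rw [← hmat, ← RingHom.map_det, h0, map_zero]

/-- **Numeric table, characteristic-`p` door**: some complex table makes the additive matrix nonsingular. -/
theorem exists_table_of_frobenius_char {ι : Type*} [Fintype ι] [DecidableEq ι]
    (u w : ι → Finset (Fin h))
    (hF : (Matrix.of fun i j : ι =>
      ((X none + ∑ a ∈ u i, X (some a) : MvPolynomial (Option (Fin h)) (ZMod p))) ^
        (∑ c ∈ w j, p ^ (c : ℕ))).det ≠ 0) :
    ∃ (ω₀ : Fin h → ℂ) (ω : Fin h → Fin h → ℂ),
      (Matrix.of fun i j : ι => ∏ c ∈ w j, (ω₀ c + ∑ a ∈ u i, ω a c)).det ≠ 0 := by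
  have hZ := det_additiveZ_ne_zero_of_frobenius_char p u w hF
  set MC : Matrix ι ι (MvPolynomial (Fin h × Option (Fin h)) ℂ) :=
    Matrix.of fun i j : ι => ∏ c ∈ w j, (X (c, none) + ∑ a ∈ u i, X (c, some a)) with hMC
  have hmap : MvPolynomial.map (Int.castRingHom ℂ) (Matrix.of fun i j : ι =>
      (∏ c ∈ w j, (X (c, none) + ∑ a ∈ u i, X (c, some a)) :
        MvPolynomial (Fin h × Option (Fin h)) ℤ)).det = MC.det := by
    rw [RingHom.map_det]
    congr 1
    refine Matrix.ext fun i j => ?_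
    rw [RingHom.mapMatrix_apply, Matrix.map_apply, Matrix.of_apply, hMC, Matrix.of_apply, map_prod]
    refine Finset.prod_congr rfl fun c _ => ?_
    rw [map_add, map_sum, map_X]
    simp_rw [map_X]
  have hC : MC.det ≠ 0 := by
    intro h0
    apply hZ
    apply MvPolynomial.map_injective (Int.castRingHom ℂ) Int.cast_injective
    rw [hmap, h0, map_zero]
  have : ∃ x : Fin h × Option (Fin h) → ℂ, eval x MC.det ≠ 0 := by
    by_contra hcon
    push Not at hcon
    exact hC (MvPolynomial.funext fun x => by rw [hcon x, map_zero])
  obtain ⟨x, hx⟩ := this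
  refine ⟨fun c => x (c, none), fun a c => x (c, some a), ?_⟩
  rw [RingHom.map_det] at hx
  convert hx using 2
  ext i j
  simp only [hMC, Matrix.of_apply, RingHom.mapMatrix_apply, Matrix.map_apply, map_prod, map_add, map_sum,
    eval_X]

/-- **THE FROBENIUS DOOR in characteristic `p`.** `h ≥ 2`; if `det [η_{u i}^{Σ_{c∈w j} p^c}] ≠ 0` in `𝔽_p[Y]`
for SOME prime `p`, the layout `(u, w)` is hit inside `SmallCircuits ℂ (h+h) 5`. -/
theorem partitionMinor_hit_of_frobenius_char {ι : Type*} [Fintype ι] [DecidableEq ι] (hh : 2 ≤ h)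
    (u w : ι → Finset (Fin h))
    (hF : (Matrix.of fun i j : ι =>
      ((X none + ∑ a ∈ u i, X (some a) : MvPolynomial (Option (Fin h)) (ZMod p))) ^
        (∑ c ∈ w j, p ^ (c : ℕ))).det ≠ 0) :
    ∃ f ∈ SmallCircuits ℂ (h + h) 5,
      (Matrix.of fun i j : ι => MvPolynomial.coeff
        (∑ a ∈ u i, Finsupp.single (Fin.castAdd h a) 1 +
          ∑ c ∈ w j, Finsupp.single (Fin.natAdd h c) 1) f).det ≠ 0 := by
  obtain ⟨ω₀, ω, hdet⟩ := exists_table_of_frobenius_char p u w hF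
  exact AdditiveDoor.partitionMinor_hit_of_additive_mem h hh u w ω₀ ω hdet

/-- Mirror of the characteristic-`p` door (`x ↔ y`). -/
theorem partitionMinor_hit_of_frobenius_char_rows {ι : Type*} [Fintype ι] [DecidableEq ι] (hh : 2 ≤ h)
    (u w : ι → Finset (Fin h))
    (hF : (Matrix.of fun i j : ι =>
      ((X none + ∑ a ∈ w i, X (some a) : MvPolynomial (Option (Fin h)) (ZMod p))) ^
        (∑ c ∈ u j, p ^ (c : ℕ))).det ≠ 0) :
    ∃ f ∈ SmallCircuits ℂ (h + h) 5,
      (Matrix.of fun i j : ι => MvPolynomial.coeff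
        (∑ a ∈ u i, Finsupp.single (Fin.castAdd h a) 1 +
          ∑ c ∈ w j, Finsupp.single (Fin.natAdd h c) 1) f).det ≠ 0 :=
  AdditiveDoor.partitionMinor_hit_symm h 5 u w (partitionMinor_hit_of_frobenius_char p hh w u hF)

end CharP

end

end Summit.ValiantsHypothesis.ValiantsHypothesis.Theorems.BarrierLever.FrobeniusDoor
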